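import Summits.HodgeConjecture.HodgeConjecture.Cruxes.BlochSeedDiscOne.DepthBoundA4

/-!
# CHARGE IDEAL LAW (hsemireg-monad-1 g14) — for EVERY integer letter design on ANY height-`h` alphabet, clause 1 of (A1) alone forces
# `μ ∈ 16(1+i)ℤ[i]`:  `16 ∣ Re μ`, `16 ∣ Im μ`, `32 ∣ Re μ + Im μ`

line stmt-HodgeConjecture-18881 Cruxes/BlochSeedDiscOne/Lines/birth.lean 814a6a70c14e831a stub_rung_pad4_seedAt

CENSUS-NEUTRAL.  Letter-model class arithmetic only (`DepthBoundA4`'s `Design`, `Design.T`, `Design.mu`, `Design.OnAlphabet`); nothing here is a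
door statement (RuleD ∕ Hall play no role), a copy bound, a sheaf, a monad or a SEED, and NOTHING toward HC ∕ HC_CM ∕ HC_AV ∕ №4 ∕ 26512 ∕ 18881 ∕ H2
is proved.  Words by director-hodge only.

WHAT IS PROVED (pen → kernel; no `decide` on designs, no `native_decide`, no axiom ∕ sorry ∕ instance ∕ notation):

* `charge_ideal_law (h : ℤ) (D : Design) : D.OnAlphabet h → A1e D → 16 ∣ D.mu.re ∧ 16 ∣ D.mu.im ∧ 32 ∣ D.mu.re + D.mu.im`
  where `A1e D` is CLAUSE 1 of the tree's `Design.A1` («every e-mixed word other than `eeee` ∕ `ēēēē` vanishes»); `a1e_of_a1 : D.A1 → A1e D`.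
  Equivalently (`charge_mem_ideal`) `∃ a b, D.mu = ⟨16·(a − b), 16·(a + b)⟩ = 16(1+i)(a + b i)`.  ANY height `h`, ANY design (no ring ∕ room ∕ role ∕
  RuleD ∕ Hall ∕ budget hypothesis, clause 2 of (A1) not used).  This is anomaly g15's THEOREM D8 ∕ (T1) («ring-2 charge ideal = 16(1+i)ℤ[i]», R19.633,
  obtained there by two exact COMPUTATIONS on the 13 ring-2 letters) made UNIVERSAL and given a half-page PEN proof; attainment (the ideal is not smaller
  on rings ≥ 2) is anomaly's D8 Method 2 and monad-1 g14 memo §5 (`chargelat2.py`; ring 1 alone realises only `32ℤ[i]`).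

PROOF (the three certificates).  For a weight table `L : Fin 4 → Sym → ℤ[i]` put `λ_w = ∏_f L f (w f)` and `G_f(ℓ) = Σ_s L f s · coef s ℓ`.  Multilinearity
(`expand`): `Σ_w λ_w · T(D)(w) = Σ_N m ∏_f G_f(ℓ_f) − Σ_P m ∏_f G_f(ℓ_f)`.  Three letter functionals: `g = 2h·1 + 2·h-coef + (1+i)·e-coef + (1−i)·ē-coef`
reads `2(h + a + x + y) ∈ 4ℤ` on the height-`h` alphabet (`a + |x| + |y| = h` ⇒ `h + a + x + y = 2h − (|x| − x) − (|y| − y)` is even); `X₂ = e + ē` reads `2x`;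
`Y₂ = i e − i ē` reads `2y`.  Tables `(g,g,X₂,X₂)`, `(g,g,X₂,Y₂)`, `(g,g,g,X₂)`: every cell term is divisible by `4·4·2·2 = 64`, `64`, `4·4·4·2 = 128`; on the
word side factors 3 (and 2) kill every e-free word and clause 1 kills every other word except `eeee`, `ēēēē`, where `λ = (1+i)²·… `:  with `μ = T(eeee)`,
`μ' = T(ēēēē)`:  `64 ∣ 2iμ − 2iμ'`, `64 ∣ −2μ − 2μ'`, `128 ∣ (−2+2i)μ + (−2−2i)μ'` in `ℤ[i]`; reading real and imaginary parts, `omega` concludes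
`16 ∣ Re μ`, `16 ∣ Im μ`, `32 ∣ Re μ + Im μ` (no use of `μ' = conj μ`).
-/

set_option linter.dupNamespace false
set_option autoImplicit false

namespace Summit.HodgeConjecture.HodgeConjecture.Cruxes.BlochSeedDiscOne.ChargeIdealLaw

open Summit.HodgeConjecture.HodgeConjecture.Cruxes.BlochSeedDiscOne.DepthBoundA4

/-! ## §0 Clause 1 of (A1) -/

/-- CLAUSE 1 of the tree's `Design.A1`: every e-mixed word other than `eeee` ∕ `ēēēē` has tensor coefficient `0`. -/
def A1e (D : Design) : Prop :=
  ∀ w : Word, ¬ w.efree → w ≠ Word.eeee → w ≠ Word.EEEE → D.T w = 0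

theorem a1e_of_a1 (D : Design) (h : D.A1) : A1e D := h.1

/-! ## §1 Weight tables and the multilinear expansion -/

/-- A weight table: one Gaussian weight per (factor, symbol). -/
abbrev Tab := Fin 4 → Sym → GaussianInt

/-- Word weight `λ_w = ∏_f L f (w f)`. -/
def lamW (L : Tab) (w : Word) : GaussianInt := ∏ f : Fin 4, L f (w f)

/-- Letter functional `G_f(ℓ) = Σ_s L f s · coef s ℓ`. -/
def G (L : Tab) (f : Fin 4) (ℓ : Letter) : GaussianInt := ∑ s : Sym, L f s * s.coef ℓ

/-- Per-cell expansion: `Σ_w λ_w · cellCoef c w = ∏_f G_f(c_f)`. -/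
theorem cell_expand (L : Tab) (c : Cell) :
    ∑ w : Word, lamW L w * cellCoef c w = ∏ f : Fin 4, G L f (c f) := by
  unfold G
  rw [Finset.prod_univ_sum, Fintype.piFinset_univ]
  refine Finset.sum_congr rfl fun w _ => ?_
  unfold lamW cellCoef
  rw [← Finset.prod_mul_distrib]

/-- Weighted list sum `Σ m · φ(cell)`. -/
def wsum (Lst : List (Cell × ℕ)) (φ : Cell → GaussianInt) : GaussianInt :=
  (Lst.map fun cm => (cm.2 : GaussianInt) * φ cm.1).sum

theorem wsum_nil (φ : Cell → GaussianInt) : wsum [] φ = 0 := by simp [wsum]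

theorem wsum_cons (a : Cell × ℕ) (t : List (Cell × ℕ)) (φ : Cell → GaussianInt) :
    wsum (a :: t) φ = (a.2 : GaussianInt) * φ a.1 + wsum t φ := by simp [wsum]

theorem T_eq_wsum (D : Design) (w : Word) :
    D.T w = wsum D.N (fun c => cellCoef c w) - wsum D.P (fun c => cellCoef c w) := rfl

theorem sum_mul_wsum (Lst : List (Cell × ℕ)) (a : Word → GaussianInt) (φ : Word → Cell → GaussianInt) :
    ∑ w : Word, a w * wsum Lst (φ w) = wsum Lst (fun c => ∑ w : Word, a w * φ w c) := by
  induction Lst with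
  | nil => simp [wsum_nil]
  | cons hd tl ih =>
    simp only [wsum_cons, mul_add, Finset.sum_add_distrib, ih, Finset.mul_sum]
    congr 1
    exact Finset.sum_congr rfl fun w _ => by ring

/-- THE EXPANSION: `Σ_w λ_w T(D)(w) = Σ_N m ∏_f G_f − Σ_P m ∏_f G_f`. -/
theorem expand (L : Tab) (D : Design) :
    ∑ w : Word, lamW L w * D.T w
      = wsum D.N (fun c => ∏ f : Fin 4, G L f (c f)) - wsum D.P (fun c => ∏ f : Fin 4, G L f (c f)) := by
  simp only [T_eq_wsum, mul_sub, Finset.sum_sub_distrib]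
  rw [sum_mul_wsum, sum_mul_wsum]
  simp only [cell_expand]

/-! ## §2 Collapse of the word side under clause 1 -/

/-- A table kills the e-free words. -/
def KillsEfree (L : Tab) : Prop := ∀ w : Word, w.efree → lamW L w = 0

theorem eeee_ne_EEEE : Word.eeee ≠ Word.EEEE := by decide

theorem collapse (L : Tab) (D : Design) (hK : KillsEfree L) (hA : A1e D) :
    ∑ w : Word, lamW L w * D.T w
      = lamW L Word.eeee * D.T Word.eeee + lamW L Word.EEEE * D.T Word.EEEE := by
  have key : ∀ w : Word, lamW L w * D.T w =
      (if w = Word.eeee then lamW L Word.eeee * D.T Word.eeee else 0) +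
      (if w = Word.EEEE then lamW L Word.EEEE * D.T Word.EEEE else 0) := by
    intro w
    by_cases h1 : w = Word.eeee
    · subst h1
      simp [eeee_ne_EEEE]
    by_cases h2 : w = Word.EEEE
    · subst h2
      simp [eeee_ne_EEEE.symm]
    by_cases he : w.efree
    · simp [h1, h2, hK w he]
    · simp [h1, h2, hA w he h1 h2]
  rw [Finset.sum_congr rfl fun w _ => key w, Finset.sum_add_distrib, Finset.sum_ite_eq', Finset.sum_ite_eq']
  simp

/-! ## §3 The three letter functionals -/

/-- `g`: `one ↦ 2h`, `h ↦ 2`, `e ↦ 1+i`, `ē ↦ 1−i`, `pt ↦ 0` — reads `2(h + a + x + y)`. -/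
def tg (h : ℤ) : Sym → GaussianInt
  | Sym.one => 2 * (h : GaussianInt)
  | Sym.h => 2
  | Sym.e => ⟨1, 1⟩
  | Sym.ebar => ⟨1, -1⟩
  | Sym.pt => 0

/-- `X₂`: `e ↦ 1`, `ē ↦ 1` — reads `2x`. -/
def tX : Sym → GaussianInt
  | Sym.e => 1
  | Sym.ebar => 1
  | Sym.one => 0
  | Sym.h => 0
  | Sym.pt => 0

/-- `Y₂`: `e ↦ i`, `ē ↦ −i` — reads `2y`. -/
def tY : Sym → GaussianInt
  | Sym.e => ⟨0, 1⟩
  | Sym.ebar => ⟨0, -1⟩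
  | Sym.one => 0
  | Sym.h => 0
  | Sym.pt => 0

theorem univ_sym : (Finset.univ : Finset Sym) = {Sym.one, Sym.h, Sym.e, Sym.ebar, Sym.pt} := by decide

theorem sum_sym (φ : Sym → GaussianInt) :
    ∑ s : Sym, φ s = φ Sym.one + φ Sym.h + φ Sym.e + φ Sym.ebar + φ Sym.pt := by
  rw [univ_sym, Finset.sum_insert (by decide), Finset.sum_insert (by decide), Finset.sum_insert (by decide),
    Finset.sum_insert (by decide), Finset.sum_singleton]
  ring

theorem read_tg (h : ℤ) (ℓ : Letter) :
    ∑ s : Sym, tg h s * s.coef ℓ = ((2 * (h + ℓ.a + ℓ.x + ℓ.y) : ℤ) : GaussianInt) := by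
  rw [sum_sym]
  ext <;> simp [tg, Sym.coef, Letter.beta, Zsqrtd.re_mul, Zsqrtd.im_mul] <;> ring

theorem read_tX (ℓ : Letter) : ∑ s : Sym, tX s * s.coef ℓ = ((2 * ℓ.x : ℤ) : GaussianInt) := by
  rw [sum_sym]
  ext
  · simp [tX, Sym.coef, Letter.beta]; ring
  · simp [tX, Sym.coef, Letter.beta]

theorem read_tY (ℓ : Letter) : ∑ s : Sym, tY s * s.coef ℓ = ((2 * ℓ.y : ℤ) : GaussianInt) := by
  rw [sum_sym]
  ext
  · simp [tY, Sym.coef, Letter.beta, Zsqrtd.re_mul]; ring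
  · simp [tY, Sym.coef, Letter.beta, Zsqrtd.im_mul]

/-- Parity on the height-`h` alphabet: `h + a + x + y` is even. -/
theorem even_of_onAlphabet {h : ℤ} {ℓ : Letter} (hℓ : ℓ.OnAlphabet h) : (2 : ℤ) ∣ h + ℓ.a + ℓ.x + ℓ.y := by
  obtain ⟨hh, _⟩ := hℓ
  unfold Letter.height at hh
  rcases abs_cases ℓ.x with ⟨hx, _⟩ | ⟨hx, _⟩ <;> rcases abs_cases ℓ.y with ⟨hy, _⟩ | ⟨hy, _⟩ <;>
    · rw [hx, hy] at hh; omega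

theorem four_dvd_tg {h : ℤ} {ℓ : Letter} (hℓ : ℓ.OnAlphabet h) :
    ((4 : ℤ) : GaussianInt) ∣ ∑ s : Sym, tg h s * s.coef ℓ := by
  rw [read_tg]
  obtain ⟨k, hk⟩ := even_of_onAlphabet hℓ
  exact ⟨(k : GaussianInt), by rw [hk]; push_cast; ring⟩

theorem two_dvd_tX (ℓ : Letter) : ((2 : ℤ) : GaussianInt) ∣ ∑ s : Sym, tX s * s.coef ℓ := by
  rw [read_tX]
  exact ⟨(ℓ.x : GaussianInt), by push_cast; ring⟩

theorem two_dvd_tY (ℓ : Letter) : ((2 : ℤ) : GaussianInt) ∣ ∑ s : Sym, tY s * s.coef ℓ := by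
  rw [read_tY]
  exact ⟨(ℓ.y : GaussianInt), by push_cast; ring⟩

/-! ## §4 The three tables -/

/-- `(g, g, X₂, X₂)`. -/
def L1 (h : ℤ) : Tab := fun f => if f = 0 ∨ f = 1 then tg h else tX
/-- `(g, g, X₂, Y₂)`. -/
def L2 (h : ℤ) : Tab := fun f => if f = 0 ∨ f = 1 then tg h else if f = 2 then tX else tY
/-- `(g, g, g, X₂)`. -/
def L3 (h : ℤ) : Tab := fun f => if f = 3 then tX else tg h

theorem tX_efree (s : Sym) (hs : s.efree = true) : tX s = 0 := by
  cases s <;> simp [Sym.efree] at hs <;> rfl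

theorem kills_of_three (L : Tab) (h3 : L 3 = tX) : KillsEfree L := by
  intro w hw
  unfold lamW
  apply Finset.prod_eq_zero (Finset.mem_univ (3 : Fin 4))
  rw [h3]
  exact tX_efree (w 3) (hw 3)

theorem kills_L1 (h : ℤ) : KillsEfree (L1 h) := kills_of_three _ (by simp [L1])
theorem kills_L2' (h : ℤ) : (L2 h) 3 = tY := by simp [L2]
theorem kills_L3 (h : ℤ) : KillsEfree (L3 h) := kills_of_three _ (by simp [L3])

theorem tY_efree (s : Sym) (hs : s.efree = true) : tY s = 0 := by
  cases s <;> simp [Sym.efree] at hs <;> rfl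

theorem kills_L2 (h : ℤ) : KillsEfree (L2 h) := by
  intro w hw
  unfold lamW
  apply Finset.prod_eq_zero (Finset.mem_univ (3 : Fin 4))
  rw [kills_L2']
  exact tY_efree (w 3) (hw 3)

/-- word weights at `eeee` ∕ `ēēēē`. -/
theorem lamW_L1_eeee (h : ℤ) : lamW (L1 h) Word.eeee = ⟨0, 2⟩ := by
  ext <;> simp [lamW, Fin.prod_univ_four, L1, tg, tX, Word.eeee, Zsqrtd.re_mul, Zsqrtd.im_mul]
theorem lamW_L1_EEEE (h : ℤ) : lamW (L1 h) Word.EEEE = ⟨0, -2⟩ := by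
  ext <;> simp [lamW, Fin.prod_univ_four, L1, tg, tX, Word.EEEE, Zsqrtd.re_mul, Zsqrtd.im_mul]
theorem lamW_L2_eeee (h : ℤ) : lamW (L2 h) Word.eeee = ⟨-2, 0⟩ := by
  ext <;> simp [lamW, Fin.prod_univ_four, L2, tg, tX, tY, Word.eeee, Zsqrtd.re_mul, Zsqrtd.im_mul]
theorem lamW_L2_EEEE (h : ℤ) : lamW (L2 h) Word.EEEE = ⟨-2, 0⟩ := by
  ext <;> simp [lamW, Fin.prod_univ_four, L2, tg, tX, tY, Word.EEEE, Zsqrtd.re_mul, Zsqrtd.im_mul]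
theorem lamW_L3_eeee (h : ℤ) : lamW (L3 h) Word.eeee = ⟨-2, 2⟩ := by
  ext <;> simp [lamW, Fin.prod_univ_four, L3, tg, tX, Word.eeee, Zsqrtd.re_mul, Zsqrtd.im_mul]
theorem lamW_L3_EEEE (h : ℤ) : lamW (L3 h) Word.EEEE = ⟨-2, -2⟩ := by
  ext <;> simp [lamW, Fin.prod_univ_four, L3, tg, tX, Word.EEEE, Zsqrtd.re_mul, Zsqrtd.im_mul]

/-! ## §5 Divisibility of the cell side -/

theorem dvd_wsum (d : GaussianInt) (Lst : List (Cell × ℕ)) (φ : Cell → GaussianInt)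
    (hφ : ∀ cm ∈ Lst, 0 < cm.2 → d ∣ φ cm.1) : d ∣ wsum Lst φ := by
  unfold wsum
  apply List.dvd_sum
  intro x hx
  obtain ⟨cm, hcm, rfl⟩ := List.mem_map.mp hx
  rcases Nat.eq_zero_or_pos cm.2 with h0 | hpos
  · simp [h0]
  · exact Dvd.dvd.mul_left (hφ cm hcm hpos) _

/-- letters of positive-multiplicity N-entries are on the alphabet. -/
theorem onAlpha_N {h : ℤ} {D : Design} (hD : D.OnAlphabet h) {cm : Cell × ℕ} (hcm : cm ∈ D.N) (hpos : 0 < cm.2)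
    (f : Fin 4) : (cm.1 f).OnAlphabet h :=
  hD cm.1 (List.mem_append.mpr (Or.inl ((mem_suppN_iff D cm.1).mpr ⟨cm.2, hcm, hpos⟩))) f

theorem onAlpha_P {h : ℤ} {D : Design} (hD : D.OnAlphabet h) {cm : Cell × ℕ} (hcm : cm ∈ D.P) (hpos : 0 < cm.2)
    (f : Fin 4) : (cm.1 f).OnAlphabet h :=
  hD cm.1 (List.mem_append.mpr (Or.inr ((mem_suppP_iff D cm.1).mpr ⟨cm.2, hcm, hpos⟩))) f

theorem prod_G (L : Tab) (c : Cell) :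
    ∏ f : Fin 4, G L f (c f) = G L 0 (c 0) * G L 1 (c 1) * G L 2 (c 2) * G L 3 (c 3) := by
  rw [Fin.prod_univ_four]

theorem cell_dvd_L1 {h : ℤ} (c : Cell) (hc : ∀ f : Fin 4, (c f).OnAlphabet h) :
    ((64 : ℤ) : GaussianInt) ∣ ∏ f : Fin 4, G (L1 h) f (c f) := by
  rw [prod_G]
  have e : ((64 : ℤ) : GaussianInt) = ((4 : ℤ) : GaussianInt) * ((4 : ℤ) : GaussianInt) * ((2 : ℤ) : GaussianInt) * ((2 : ℤ) : GaussianInt) := by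
    push_cast; norm_num
  rw [e]
  refine mul_dvd_mul (mul_dvd_mul (mul_dvd_mul ?_ ?_) ?_) ?_
  · simpa [G, L1] using four_dvd_tg (hc 0)
  · simpa [G, L1] using four_dvd_tg (hc 1)
  · simpa [G, L1] using two_dvd_tX (c 2)
  · simpa [G, L1] using two_dvd_tX (c 3)

theorem cell_dvd_L2 {h : ℤ} (c : Cell) (hc : ∀ f : Fin 4, (c f).OnAlphabet h) :
    ((64 : ℤ) : GaussianInt) ∣ ∏ f : Fin 4, G (L2 h) f (c f) := by
  rw [prod_G]
  have e : ((64 : ℤ) : GaussianInt) = ((4 : ℤ) : GaussianInt) * ((4 : ℤ) : GaussianInt) * ((2 : ℤ) : GaussianInt) * ((2 : ℤ) : GaussianInt) := by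
    push_cast; norm_num
  rw [e]
  refine mul_dvd_mul (mul_dvd_mul (mul_dvd_mul ?_ ?_) ?_) ?_
  · simpa [G, L2] using four_dvd_tg (hc 0)
  · simpa [G, L2] using four_dvd_tg (hc 1)
  · simpa [G, L2] using two_dvd_tX (c 2)
  · simpa [G, L2] using two_dvd_tY (c 3)

theorem cell_dvd_L3 {h : ℤ} (c : Cell) (hc : ∀ f : Fin 4, (c f).OnAlphabet h) :
    ((128 : ℤ) : GaussianInt) ∣ ∏ f : Fin 4, G (L3 h) f (c f) := by
  rw [prod_G]
  have e : ((128 : ℤ) : GaussianInt) = ((4 : ℤ) : GaussianInt) * ((4 : ℤ) : GaussianInt) * ((4 : ℤ) : GaussianInt) * ((2 : ℤ) : GaussianInt) := by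
    push_cast; norm_num
  rw [e]
  refine mul_dvd_mul (mul_dvd_mul (mul_dvd_mul ?_ ?_) ?_) ?_
  · simpa [G, L3] using four_dvd_tg (hc 0)
  · simpa [G, L3] using four_dvd_tg (hc 1)
  · simpa [G, L3] using four_dvd_tg (hc 2)
  · simpa [G, L3] using two_dvd_tX (c 3)

/-- the design-level divisibility of `Σ_w λ_w T(w)` for a table whose cell products are all divisible by `d`. -/
theorem design_dvd {h : ℤ} (L : Tab) (d : GaussianInt) (D : Design) (hD : D.OnAlphabet h)
    (hcell : ∀ c : Cell, (∀ f : Fin 4, (c f).OnAlphabet h) → d ∣ ∏ f : Fin 4, G L f (c f)) :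
    d ∣ ∑ w : Word, lamW L w * D.T w := by
  rw [expand]
  refine dvd_sub ?_ ?_
  · exact dvd_wsum d D.N _ fun cm hcm hpos => hcell cm.1 (onAlpha_N hD hcm hpos)
  · exact dvd_wsum d D.P _ fun cm hcm hpos => hcell cm.1 (onAlpha_P hD hcm hpos)

/-! ## §6 THE LAW -/

/-- **CHARGE IDEAL LAW.**  On any height-`h` alphabet, clause 1 of (A1) forces `16 ∣ Re μ`, `16 ∣ Im μ`, `32 ∣ Re μ + Im μ`. -/
theorem charge_ideal_law (h : ℤ) (D : Design) (hD : D.OnAlphabet h) (hA : A1e D) :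
    (16 : ℤ) ∣ D.mu.re ∧ (16 : ℤ) ∣ D.mu.im ∧ (32 : ℤ) ∣ D.mu.re + D.mu.im := by
  have h1 := design_dvd (L1 h) _ D hD (fun c hc => cell_dvd_L1 c hc)
  have h2 := design_dvd (L2 h) _ D hD (fun c hc => cell_dvd_L2 c hc)
  have h3 := design_dvd (L3 h) _ D hD (fun c hc => cell_dvd_L3 c hc)
  rw [collapse _ D (kills_L1 h) hA, lamW_L1_eeee, lamW_L1_EEEE] at h1
  rw [collapse _ D (kills_L2 h) hA, lamW_L2_eeee, lamW_L2_EEEE] at h2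
  rw [collapse _ D (kills_L3 h) hA, lamW_L3_eeee, lamW_L3_EEEE] at h3
  rw [Zsqrtd.intCast_dvd] at h1 h2 h3
  obtain ⟨h1r, h1i⟩ := h1
  obtain ⟨h2r, h2i⟩ := h2
  obtain ⟨h3r, h3i⟩ := h3
  simp only [Zsqrtd.re_add, Zsqrtd.im_add, Zsqrtd.re_mul, Zsqrtd.im_mul] at h1r h1i h2r h2i h3r h3i
  unfold Design.mu
  omega

/-- The same law from the tree's full (A1). -/
theorem charge_ideal_law_of_A1 (h : ℤ) (D : Design) (hD : D.OnAlphabet h) (hA : D.A1) :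
    (16 : ℤ) ∣ D.mu.re ∧ (16 : ℤ) ∣ D.mu.im ∧ (32 : ℤ) ∣ D.mu.re + D.mu.im :=
  charge_ideal_law h D hD (a1e_of_a1 D hA)

/-- Ideal form: `μ = 16(1+i)·(a + b i)` for some integers `a, b`. -/
theorem charge_mem_ideal (h : ℤ) (D : Design) (hD : D.OnAlphabet h) (hA : A1e D) :
    ∃ a b : ℤ, D.mu = ⟨16 * (a - b), 16 * (a + b)⟩ := by
  obtain ⟨hre, him, hsum⟩ := charge_ideal_law h D hD hA
  obtain ⟨r, hr⟩ := hre
  obtain ⟨s, hs⟩ := him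
  obtain ⟨t, ht⟩ := hsum
  refine ⟨(r + s) / 2, (s - r) / 2, ?_⟩
  ext
  · simp only; omega
  · simp only; omega

/-- Consequently `|μ|_∞ ≥ 16` for every CHARGED design: `μ ≠ 0 → 16 ≤ |Re μ| ∨ 16 ≤ |Im μ|`. -/
theorem sixteen_le_of_charged (h : ℤ) (D : Design) (hD : D.OnAlphabet h) (hA : A1e D) (hμ : D.mu ≠ 0) :
    16 ≤ |D.mu.re| ∨ 16 ≤ |D.mu.im| := by
  obtain ⟨hre, him, -⟩ := charge_ideal_law h D hD hA
  by_contra hcon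
  push Not at hcon
  obtain ⟨h1, h2⟩ := hcon
  apply hμ
  have hr : D.mu.re = 0 := by
    obtain ⟨r, hr⟩ := hre
    rcases abs_cases D.mu.re with ⟨ha, _⟩ | ⟨ha, _⟩ <;> · rw [ha] at h1; omega
  have hi : D.mu.im = 0 := by
    obtain ⟨s, hs⟩ := him
    rcases abs_cases D.mu.im with ⟨ha, _⟩ | ⟨ha, _⟩ <;> · rw [ha] at h2; omega
  ext <;> simp [hr, hi]

end Summit.HodgeConjecture.HodgeConjecture.Cruxes.BlochSeedDiscOne.ChargeIdealLaw
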